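import Summits.ABC.StewartYu.RecordByName
import HarnessLib

/-!
# Cell abc-stewartyu, Gen-3 record (WP-M3.R): the record predicates are DOWNWARD CLOSED in the degree
# slots — `RecordTwo` / `RecordOdd` for every `1 ≤ D₀' ≤ P.D₀`, `1 ≤ D' j ≤ P.D j`

`Summits/ABC/StewartYu/RecordByNameLe.lean` — cell `abc-stewartyu` (HOME `run/shared/lean/pub/abc-stewartyu/`),
route `PadicPrimesKummerThird`, cruxes `Y07Odd` (stmt-ABC-19658) / `Y07Two` (stmt-ABC-19659); seat lp-1 (g2).
Theorems only.  GLUE for the frames' ∃-assemblies (STATUS lp-1 2026-08-27T02:5xZ): p2's `RecordSupplyAt` feeds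
`RecordOdd … L₀ S₀ X' (fun j => 2·Lb s Ŝ j)` with the Siegel degree `L₀` (the record has `P.D₀ = P.L₀ + 1`) and an
even END degree; the record's exits (A)/(B)/(C) hold verbatim for any SMALLER degree data, so:

* `exitA_le`, `exitB_le`, `Q_le_Q`, `exitC_two_le`, `exitC_odd_le` — the three exits for `(D₀', D')` with
  `1 ≤ D₀' ≤ P.D₀`, `1 ≤ D' j ≤ P.D j` ((A): `K2` is monotone in `D₀`; (B): `∏ D' ≤ ∏ P.D`, `D₀` cancels at
  `d₀ = 1`; (C): `Pmax(D₀') ≤ Pmax(P.D₀)`);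
* `recordTwo_le`, `recordOdd_le` — `RecordTwo/RecordOdd (fun m => 256^m) … D₀' P.S₀N P.Xfin D'` under the
  instantiation convention.

References: Yu. V. Nesterenko, LNM 1819 (2003), §5.2 (5.13)–(5.22).
-/

noncomputable section

open Finset Real Nat

namespace Summit.ABC.StewartYu

namespace PadicG3Par

open Summit.ABC.StewartYu.GenThreeFrameSpecTwo (RecordTwo)
open Summit.ABC.StewartYu.GenThreeFrameSpecOdd (RecordOdd)

variable {n : ℕ} (P : PadicG3Par n)

/-- Exit A for any `1 ≤ D₀' ≤ P.D₀` (same `Dmax = L/2^{n+22}+1`). [cite: Nesterenko2003, §5.2 (5.14)–(5.17)] -/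
theorem exitA_le {D₀' : ℕ} (h1 : 1 ≤ D₀') (hle : D₀' ≤ P.D₀) : ∀ r d₀ : ℕ, r ≤ n → d₀ ≤ 1 →
    (n + 1).factorial * 2 ^ n * D₀' * (P.L / 2 ^ (n + 22) + 1) ^ r <
      Nat.choose (P.S₀N + (r + 1 - d₀)) (r + 1 - d₀) * (2 * P.Xfin + 1) *
        ((d₀ + (n - r)).factorial * 2 ^ (n - r) * D₀' ^ d₀) :=
  RecordExitsNumeric.exitA_of_bounds P.one_le_Xfin h1 P.K1
    (lt_of_le_of_lt (Nat.mul_le_mul_left _ hle) P.K2)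

/-- Exit B for any `1 ≤ D₀' ≤ P.D₀`, `D' ≤ P.D`. [cite: Nesterenko2003, §5.2 Lemma 5.4] -/
theorem exitB_le (hKNq : P.K ≤ P.Nq) {D₀' : ℕ} (h1 : 1 ≤ D₀') (hle : D₀' ≤ P.D₀)
    {D' : Fin n → ℕ} (hD' : ∀ j, D' j ≤ P.D j) : ∀ d₀ : ℕ, d₀ ≤ 1 →
    (n + 1).factorial * 2 ^ n * D₀' * ∏ j, D' j <
      Nat.choose (P.S₀N + (n - d₀)) (n - d₀) * (2 * P.Xfin + 1) * (d₀.factorial * D₀' ^ d₀) := by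
  intro d₀ hd₀
  have hB := P.exitB hKNq d₀ hd₀
  have hprod : ∏ j, D' j ≤ ∏ j, P.D j := prod_le_prod' fun j _ => hD' j
  have hD₀ : 0 < P.D₀ := by unfold D₀; omega
  rcases Nat.le_one_iff_eq_zero_or_eq_one.mp hd₀ with rfl | rfl
  · simp only [Nat.factorial_zero, pow_zero, mul_one] at hB ⊢
    calc (n + 1)! * 2 ^ n * D₀' * ∏ j, D' j ≤ (n + 1)! * 2 ^ n * P.D₀ * ∏ j, P.D j :=
          Nat.mul_le_mul (Nat.mul_le_mul_left _ hle) hprod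
      _ < _ := hB
  · simp only [Nat.factorial_one, pow_one, one_mul] at hB ⊢
    -- cancel `P.D₀` in `hB`, then multiply by `D₀'`
    have hB' : (n + 1)! * 2 ^ n * ∏ j, P.D j < Nat.choose (P.S₀N + (n - 1)) (n - 1) * (2 * P.Xfin + 1) := by
      by_contra hcon
      push Not at hcon
      have : Nat.choose (P.S₀N + (n - 1)) (n - 1) * (2 * P.Xfin + 1) * P.D₀ ≤
          (n + 1)! * 2 ^ n * P.D₀ * ∏ j, P.D j := by
        calc Nat.choose (P.S₀N + (n - 1)) (n - 1) * (2 * P.Xfin + 1) * P.D₀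
            ≤ ((n + 1)! * 2 ^ n * ∏ j, P.D j) * P.D₀ := Nat.mul_le_mul_right _ hcon
          _ = (n + 1)! * 2 ^ n * P.D₀ * ∏ j, P.D j := by ring
      omega
    calc (n + 1)! * 2 ^ n * D₀' * ∏ j, D' j ≤ ((n + 1)! * 2 ^ n * ∏ j, P.D j) * D₀' := by
          calc (n + 1)! * 2 ^ n * D₀' * ∏ j, D' j ≤ (n + 1)! * 2 ^ n * D₀' * ∏ j, P.D j :=
                Nat.mul_le_mul_left _ hprod
            _ = ((n + 1)! * 2 ^ n * ∏ j, P.D j) * D₀' := by ring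
      _ < Nat.choose (P.S₀N + (n - 1)) (n - 1) * (2 * P.Xfin + 1) * D₀' :=
          Nat.mul_lt_mul_of_pos_right hB' (by omega)

/-- `Pmax(D₀') ≤ Pmax(P.D₀)` for `D₀' ≤ P.D₀` (equality at `d₀ = 1`, monotone at `d₀ = 0`), and `0 < Pmax(D₀')`.
[folklore] -/
theorem Q_le_Q {D₀' : ℕ} (h1 : 1 ≤ D₀') (hle : D₀' ≤ P.D₀) (r d₀ : ℕ) (hd₀ : d₀ ≤ 1) :
    0 < ((r ! : ℕ) : ℝ) ^ 2 * (n : ℝ) ^ r *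
        (((((n + 1)! * 2 ^ n * D₀' : ℕ) : ℝ) * ((P.Nq : ℝ) * P.L / 2 ^ P.Sdepth + P.Amax) ^ r /
          ((Nat.choose (P.S₀N + (r - d₀)) (r - d₀) * (2 * P.Xfin + 1) *
            ((d₀ + (n - r))! * 2 ^ (n - r) * D₀' ^ d₀) : ℕ) : ℝ))) ∧
    ((r ! : ℕ) : ℝ) ^ 2 * (n : ℝ) ^ r *
        (((((n + 1)! * 2 ^ n * D₀' : ℕ) : ℝ) * ((P.Nq : ℝ) * P.L / 2 ^ P.Sdepth + P.Amax) ^ r /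
          ((Nat.choose (P.S₀N + (r - d₀)) (r - d₀) * (2 * P.Xfin + 1) *
            ((d₀ + (n - r))! * 2 ^ (n - r) * D₀' ^ d₀) : ℕ) : ℝ))) ≤
    ((r ! : ℕ) : ℝ) ^ 2 * (n : ℝ) ^ r *
        (((((n + 1)! * 2 ^ n * P.D₀ : ℕ) : ℝ) * ((P.Nq : ℝ) * P.L / 2 ^ P.Sdepth + P.Amax) ^ r /
          ((Nat.choose (P.S₀N + (r - d₀)) (r - d₀) * (2 * P.Xfin + 1) *
            ((d₀ + (n - r))! * 2 ^ (n - r) * P.D₀ ^ d₀) : ℕ) : ℝ))) := by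
  have hΛ : 0 < (P.Nq : ℝ) * P.L / 2 ^ P.Sdepth + P.Amax := by have := P.hAmax1; positivity
  have hn : (0 : ℝ) < n := by exact_mod_cast P.hn
  have hr : (0 : ℝ) < ((r ! : ℕ) : ℝ) := by exact_mod_cast Nat.factorial_pos r
  have hch : 0 < Nat.choose (P.S₀N + (r - d₀)) (r - d₀) := Nat.choose_pos (Nat.le_add_left _ _)
  have hfa : 0 < (d₀ + (n - r))! := Nat.factorial_pos _
  have hD₀ : 0 < P.D₀ := by unfold D₀; omega
  have hden' : (0 : ℝ) < ((Nat.choose (P.S₀N + (r - d₀)) (r - d₀) * (2 * P.Xfin + 1) *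
      ((d₀ + (n - r))! * 2 ^ (n - r) * D₀' ^ d₀) : ℕ) : ℝ) := by
    have : 0 < D₀' ^ d₀ := pow_pos (by omega) _
    positivity
  have hN' : (0 : ℝ) < (((n + 1)! * 2 ^ n * D₀' : ℕ) : ℝ) := by
    have : 0 < D₀' := by omega
    positivity
  refine ⟨by positivity, ?_⟩
  apply mul_le_mul_of_nonneg_left _ (by positivity)
  rcases Nat.le_one_iff_eq_zero_or_eq_one.mp hd₀ with rfl | rfl
  · -- `d₀ = 0`: same denominator, numerator monotone
    simp only [pow_zero, mul_one]
    apply div_le_div_of_nonneg_right _ (by positivity)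
    apply mul_le_mul_of_nonneg_right _ (by positivity)
    exact_mod_cast Nat.mul_le_mul_left _ hle
  · -- `d₀ = 1`: `D₀` cancels
    simp only [pow_one]
    have hD₀' : (0 : ℝ) < D₀' := by exact_mod_cast (show 0 < D₀' by omega)
    have hD₀r : (0 : ℝ) < P.D₀ := by exact_mod_cast hD₀
    have hc : (0 : ℝ) < ((Nat.choose (P.S₀N + (r - 1)) (r - 1) : ℕ) : ℝ) * (2 * (P.Xfin : ℝ) + 1) *
        ((((1 + (n - r))! : ℕ) : ℝ) * 2 ^ (n - r)) := by positivity
    rw [div_le_div_iff₀ (by push_cast; positivity) (by push_cast; positivity)]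
    push_cast
    have : (((n + 1)! : ℕ) : ℝ) * 2 ^ n * (D₀' : ℝ) * ((P.Nq : ℝ) * P.L / 2 ^ P.Sdepth + P.Amax) ^ r *
        (((Nat.choose (P.S₀N + (r - 1)) (r - 1) : ℕ) : ℝ) * (2 * (P.Xfin : ℝ) + 1) *
          ((((1 + (n - r))! : ℕ) : ℝ) * 2 ^ (n - r) * (P.D₀ : ℝ))) =
      (((n + 1)! : ℕ) : ℝ) * 2 ^ n * (P.D₀ : ℝ) * ((P.Nq : ℝ) * P.L / 2 ^ P.Sdepth + P.Amax) ^ r *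
        (((Nat.choose (P.S₀N + (r - 1)) (r - 1) : ℕ) : ℝ) * (2 * (P.Xfin : ℝ) + 1) *
          ((((1 + (n - r))! : ℕ) : ℝ) * 2 ^ (n - r) * (D₀' : ℝ))) := by ring
    rw [this]

/-- **Clause (C) (odd `p`) for any `1 ≤ D₀' ≤ P.D₀`**, with `C m = 256^m`. [cite: Nesterenko2003, §5.2 (5.22)] -/
theorem exitC_odd_le (hKNq : P.K ≤ P.Nq) (hNqK : P.Nq ≤ 2 ^ n * P.K) (hθ : (1 / 2 : ℝ) ≤ P.θ₀)
    (hAmax : P.Amax ≤ 2 ^ n * P.Ω) (hA1 : ∀ j, 1 ≤ P.A j) (p : ℕ) {D₀' : ℕ} (h1 : 1 ≤ D₀') (hle : D₀' ≤ P.D₀)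
    {C : ℕ → ℝ} (hC0 : ∀ r, 0 ≤ C r) (hCg : ∀ r, r < n → (256 : ℝ) ^ (n - r) * C r ≤ C n) :
    ∀ r d₀ : ℕ, 0 < r → r < n → d₀ ≤ 1 →
      C r * (((r.factorial : ℝ)) ^ 2 * (n : ℝ) ^ r *
              ((((n + 1).factorial * 2 ^ n * D₀' : ℕ) : ℝ) *
                ((P.Nq : ℝ) * P.L / 2 ^ P.Sdepth + P.Amax) ^ r /
                ((Nat.choose (P.S₀N + (r - d₀)) (r - d₀) * (2 * P.Xfin + 1) *
                  ((d₀ + (n - r)).factorial * 2 ^ (n - r) * D₀' ^ d₀) : ℕ) : ℝ))) *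
          (P.W + Real.log 3 + Real.log n + Real.log P.Amax +
            Real.log (((r.factorial : ℝ)) ^ 2 * (n : ℝ) ^ r *
              ((((n + 1).factorial * 2 ^ n * D₀' : ℕ) : ℝ) *
                ((P.Nq : ℝ) * P.L / 2 ^ P.Sdepth + P.Amax) ^ r /
                ((Nat.choose (P.S₀N + (r - d₀)) (r - d₀) * (2 * P.Xfin + 1) *
                  ((d₀ + (n - r)).factorial * 2 ^ (n - r) * D₀' ^ d₀) : ℕ) : ℝ))) +
            Real.log p +
            Real.log (2 * (((r.factorial : ℝ)) ^ 2 * (n : ℝ) ^ r *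
              ((((n + 1).factorial * 2 ^ n * D₀' : ℕ) : ℝ) *
                ((P.Nq : ℝ) * P.L / 2 ^ P.Sdepth + P.Amax) ^ r /
                ((Nat.choose (P.S₀N + (r - d₀)) (r - d₀) * (2 * P.Xfin + 1) *
                  ((d₀ + (n - r)).factorial * 2 ^ (n - r) * D₀' ^ d₀) : ℕ) : ℝ))))) ≤
        C n * (∏ j, P.A j) * (P.W + Real.log p + Real.log (2 * P.Amax)) := by
  intro r d₀ hr0 hrn hd₀
  obtain ⟨hQ0, hQQ⟩ := P.Q_le_Q h1 hle r d₀ hd₀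
  have hQ : ((r ! : ℕ) : ℝ) ^ 2 * (n : ℝ) ^ r *
        (((((n + 1)! * 2 ^ n * P.D₀ : ℕ) : ℝ) * ((P.Nq : ℝ) * P.L / 2 ^ P.Sdepth + P.Amax) ^ r /
          ((Nat.choose (P.S₀N + (r - d₀)) (r - d₀) * (2 * P.Xfin + 1) *
            ((d₀ + (n - r))! * 2 ^ (n - r) * P.D₀ ^ d₀) : ℕ) : ℝ))) * (14 * n + 3) ≤
      (256 : ℝ) ^ (n - r) * P.Ω := by
    rcases Nat.le_one_iff_eq_zero_or_eq_one.mp hd₀ with rfl | rfl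
    · exact P.Q_mul_le_zero hKNq hNqK hθ hAmax hA1 hr0 hrn (hnum0_holds n r hr0 hrn)
    · exact P.Q_mul_le_one hKNq hNqK hθ hAmax hA1 hr0 hrn (hnum1_holds n r hr0 hrn)
  have hQ' := le_trans (mul_le_mul_of_nonneg_right hQQ (by positivity)) hQ
  exact P.clauseC_final hC0 hCg hrn hQ0 (Real.log_natCast_nonneg p) hQ'

/-- **Clause (C) (`p = 2`) for any `1 ≤ D₀' ≤ P.D₀`**. [cite: Nesterenko2003, §5.2 (5.22)] -/
theorem exitC_two_le (hKNq : P.K ≤ P.Nq) (hNqK : P.Nq ≤ 2 ^ n * P.K) (hθ : (1 / 2 : ℝ) ≤ P.θ₀)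
    (hAmax : P.Amax ≤ 2 ^ n * P.Ω) (hA1 : ∀ j, 1 ≤ P.A j) {D₀' : ℕ} (h1 : 1 ≤ D₀') (hle : D₀' ≤ P.D₀)
    {C : ℕ → ℝ} (hC0 : ∀ r, 0 ≤ C r) (hCg : ∀ r, r < n → (256 : ℝ) ^ (n - r) * C r ≤ C n) :
    ∀ r d₀ : ℕ, 0 < r → r < n → d₀ ≤ 1 →
      C r * (((r.factorial : ℝ)) ^ 2 * (n : ℝ) ^ r *
              ((((n + 1).factorial * 2 ^ n * D₀' : ℕ) : ℝ) *
                ((P.Nq : ℝ) * P.L / 2 ^ P.Sdepth + P.Amax) ^ r /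
                ((Nat.choose (P.S₀N + (r - d₀)) (r - d₀) * (2 * P.Xfin + 1) *
                  ((d₀ + (n - r)).factorial * 2 ^ (n - r) * D₀' ^ d₀) : ℕ) : ℝ))) *
          (P.W + Real.log 3 + Real.log n + Real.log P.Amax +
            Real.log (((r.factorial : ℝ)) ^ 2 * (n : ℝ) ^ r *
              ((((n + 1).factorial * 2 ^ n * D₀' : ℕ) : ℝ) *
                ((P.Nq : ℝ) * P.L / 2 ^ P.Sdepth + P.Amax) ^ r /
                ((Nat.choose (P.S₀N + (r - d₀)) (r - d₀) * (2 * P.Xfin + 1) *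
                  ((d₀ + (n - r)).factorial * 2 ^ (n - r) * D₀' ^ d₀) : ℕ) : ℝ))) +
            Real.log (2 * (((r.factorial : ℝ)) ^ 2 * (n : ℝ) ^ r *
              ((((n + 1).factorial * 2 ^ n * D₀' : ℕ) : ℝ) *
                ((P.Nq : ℝ) * P.L / 2 ^ P.Sdepth + P.Amax) ^ r /
                ((Nat.choose (P.S₀N + (r - d₀)) (r - d₀) * (2 * P.Xfin + 1) *
                  ((d₀ + (n - r)).factorial * 2 ^ (n - r) * D₀' ^ d₀) : ℕ) : ℝ))))) ≤
        C n * (∏ j, P.A j) * (P.W + Real.log (2 * P.Amax)) := by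
  intro r d₀ hr0 hrn hd₀
  obtain ⟨hQ0, hQQ⟩ := P.Q_le_Q h1 hle r d₀ hd₀
  have hQ : ((r ! : ℕ) : ℝ) ^ 2 * (n : ℝ) ^ r *
        (((((n + 1)! * 2 ^ n * P.D₀ : ℕ) : ℝ) * ((P.Nq : ℝ) * P.L / 2 ^ P.Sdepth + P.Amax) ^ r /
          ((Nat.choose (P.S₀N + (r - d₀)) (r - d₀) * (2 * P.Xfin + 1) *
            ((d₀ + (n - r))! * 2 ^ (n - r) * P.D₀ ^ d₀) : ℕ) : ℝ))) * (14 * n + 3) ≤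
      (256 : ℝ) ^ (n - r) * P.Ω := by
    rcases Nat.le_one_iff_eq_zero_or_eq_one.mp hd₀ with rfl | rfl
    · exact P.Q_mul_le_zero hKNq hNqK hθ hAmax hA1 hr0 hrn (hnum0_holds n r hr0 hrn)
    · exact P.Q_mul_le_one hKNq hNqK hθ hAmax hA1 hr0 hrn (hnum1_holds n r hr0 hrn)
  have hQ' := le_trans (mul_le_mul_of_nonneg_right hQQ (by positivity)) hQ
  have h := P.clauseC_final hC0 hCg hrn hQ0 le_rfl hQ'
  simpa only [add_zero] using h

/-- **`RecordOdd` for any smaller degree data**: `1 ≤ D₀' ≤ P.D₀`, `1 ≤ D' j ≤ P.D j`, `C m = 256^m`, any `p`,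
under the instantiation convention. [cite: Nesterenko2003, §5.2 (5.13)–(5.22)] -/
theorem recordOdd_le (hKNq : P.K ≤ P.Nq) (hNqK : P.Nq ≤ 2 ^ n * P.K) (hθ : (1 / 2 : ℝ) ≤ P.θ₀)
    (hAmax : P.Amax ≤ 2 ^ n * P.Ω) (hA1 : ∀ j, 1 ≤ P.A j) (p : ℕ)
    {D₀' : ℕ} (h1 : 1 ≤ D₀') (hle : D₀' ≤ P.D₀) {D' : Fin n → ℕ} (hD'1 : ∀ j, 1 ≤ D' j)
    (hD' : ∀ j, D' j ≤ P.D j) :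
    RecordOdd (fun m => (256 : ℝ) ^ m) p n P.A P.Amax P.W D₀' P.S₀N P.Xfin D' :=
  RecordExits.recordOdd_of_ineqs (pow256_admissible n).1 P.hn hA1 P.hAmax1 (by linarith [P.hW])
    h1 hD'1 (fun j => (hD' j).trans (P.D_le_Dmax j))
    (fun j => le_trans (mul_le_mul_of_nonneg_right (by exact_mod_cast hD' j) (P.A_pos j).le) (P.D_mul_A_le j))
    (P.exitA_le h1 hle) (P.exitB_le hKNq h1 hle hD')
    (P.exitC_odd_le hKNq hNqK hθ hAmax hA1 p h1 hle (pow256_admissible n).1 (pow256_admissible n).2)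

/-- **`RecordTwo` for any smaller degree data**, same hypotheses. [cite: Nesterenko2003, §5.2 (5.13)–(5.22)] -/
theorem recordTwo_le (hKNq : P.K ≤ P.Nq) (hNqK : P.Nq ≤ 2 ^ n * P.K) (hθ : (1 / 2 : ℝ) ≤ P.θ₀)
    (hAmax : P.Amax ≤ 2 ^ n * P.Ω) (hA1 : ∀ j, 1 ≤ P.A j)
    {D₀' : ℕ} (h1 : 1 ≤ D₀') (hle : D₀' ≤ P.D₀) {D' : Fin n → ℕ} (hD'1 : ∀ j, 1 ≤ D' j)
    (hD' : ∀ j, D' j ≤ P.D j) :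
    RecordTwo (fun m => (256 : ℝ) ^ m) n P.A P.Amax P.W D₀' P.S₀N P.Xfin D' :=
  RecordExits.recordTwo_of_ineqs (pow256_admissible n).1 P.hn hA1 P.hAmax1 (by linarith [P.hW])
    h1 hD'1 (fun j => (hD' j).trans (P.D_le_Dmax j))
    (fun j => le_trans (mul_le_mul_of_nonneg_right (by exact_mod_cast hD' j) (P.A_pos j).le) (P.D_mul_A_le j))
    (P.exitA_le h1 hle) (P.exitB_le hKNq h1 hle hD')
    (P.exitC_two_le hKNq hNqK hθ hAmax hA1 h1 hle (pow256_admissible n).1 (pow256_admissible n).2)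

end PadicG3Par

end Summit.ABC.StewartYu

end
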